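import Summits.ResolutionOfSingularities.ResolutionOfSingularities.Theorems.ConeExit.Negative.Mirror

/-!
# Cone algebra for `NoPeriodicIsolatedAtom` / line `ridge_rank` — toolkit (1/·): the invariance
# identity `P(X + wS) = P(X) + P(w) S^p` is stable under substitution and cuts out a subspace

For a polynomial `P ∈ κ[X_j : j < n]` and an exponent `p`, the *invariance identity at `w ∈ κⁿ`* is
`aeval (j ↦ X (some j) + C (w j) * X none) P = rename some P + C (eval w P) * (X none) ^ p`
in `κ[Option (Fin n)]` (the mirror's `Linv p c` is the set of `w` satisfying it for `P = cone p c`).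
We prove: the identity transports to every polynomial substitution (`linv_subst`); its constant is
forced (`linv_of_const`); the solution set is closed under `0`, `+`, `•` when `P` has no constant term,
hence is (the carrier of) a submodule and equals its own span (`span_linv_eq_self`); and a peeling
formula for sums of solutions (`linv_peel`).
-/

noncomputable section

-- single-problem summit: the doubled namespace component is forced by the tree layout
set_option linter.dupNamespace false

namespace Summit.ResolutionOfSingularities.ResolutionOfSingularities.Theorems.NoPeriodicIsolatedAtom.RidgeRank

open scoped BigOperators Classical
open MvPolynomial

variable {n : ℕ} {κ : Type} [Field κ] {p : ℕ}

/-- **Substitution form.** If `P(X + wS) = P(X) + P(w) S^p` then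
`P(g + w Q) = P(g) + P(w) Q^p` for every polynomial substitution `g, Q`. [folklore] -/
theorem linv_subst (P : MvPolynomial (Fin n) κ) (w : Fin n → κ)
    (hw : aeval (fun j : Fin n => (X (some j) : MvPolynomial (Option (Fin n)) κ) + C (w j) * X none) P =
      rename some P + C (eval w P) * (X none) ^ p)
    {σ : Type} (g : Fin n → MvPolynomial σ κ) (Q : MvPolynomial σ κ) :
    aeval (fun j => g j + C (w j) * Q) P = aeval g P + C (eval w P) * Q ^ p := by
  have h := congrArg (aeval (fun o : Option (Fin n) => Option.elim o Q g)) hw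
  rw [comp_aeval_apply, map_add, map_mul, map_pow, aeval_rename, algHom_C, aeval_X,
    algebraMap_eq] at h
  have e1 : (fun i => aeval (fun o : Option (Fin n) => Option.elim o Q g)
      ((X (some i) : MvPolynomial (Option (Fin n)) κ) + C (w i) * X none)) = fun j => g j + C (w j) * Q := by
    funext j; simp [algebraMap_eq]
  have e2 : ((fun o : Option (Fin n) => Option.elim o Q g) ∘ some) = g := by
    funext j; simp
  rw [e1, e2] at h
  simpa using h

/-- **The constant is forced.** If `P` has no constant term and `P(X + wS) = P(X) + e S^p` for some
constant `e`, then `e = P(w)` (evaluate at `X = 0`, `S = 1`). [folklore] -/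
theorem linv_of_const (P : MvPolynomial (Fin n) κ) (hP : constantCoeff P = 0) (w : Fin n → κ) (e : κ)
    (he : aeval (fun j : Fin n => (X (some j) : MvPolynomial (Option (Fin n)) κ) + C (w j) * X none) P =
      rename some P + C e * (X none) ^ p) :
    aeval (fun j : Fin n => (X (some j) : MvPolynomial (Option (Fin n)) κ) + C (w j) * X none) P =
      rename some P + C (eval w P) * (X none) ^ p := by
  suffices hew : eval w P = e by rw [hew]; exact he
  have h := congrArg (aeval (fun o : Option (Fin n) => Option.elim o (1 : κ) (fun _ => 0))) he
  rw [comp_aeval_apply, map_add, map_mul, map_pow, aeval_rename, algHom_C, aeval_X] at h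
  have e1 : (fun i => aeval (fun o : Option (Fin n) => Option.elim o (1 : κ) (fun _ => 0))
      ((X (some i) : MvPolynomial (Option (Fin n)) κ) + C (w i) * X none)) = w := by
    funext j; simp
  have e2 : ((fun o : Option (Fin n) => Option.elim o (1 : κ) (fun _ => 0)) ∘ some) = (0 : Fin n → κ) := by
    funext j; simp
  rw [e1, e2, show aeval (0 : Fin n → κ) P = eval 0 P from rfl, eval_zero] at h
  simp only [Option.elim_none, one_pow, mul_one, Algebra.algebraMap_self_apply] at h
  rw [hP, zero_add] at h
  rw [← h]
  rfl

/-- `0` satisfies the invariance identity iff `P` has no constant term; here the direction we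
need. [folklore] -/
theorem linv_zero (p : ℕ) (P : MvPolynomial (Fin n) κ) (hP : constantCoeff P = 0) :
    aeval (fun j : Fin n => (X (some j) : MvPolynomial (Option (Fin n)) κ) + C ((0 : Fin n → κ) j) * X none) P =
      rename some P + C (eval (0 : Fin n → κ) P) * (X none) ^ p := by
  rw [eval_zero, hP]
  simp only [Pi.zero_apply, C_0, zero_mul, add_zero]
  rw [rename_eq_aeval]
  rfl

/-- The solution set of the invariance identity is closed under addition (no constant term).
[folklore] -/
theorem linv_add (P : MvPolynomial (Fin n) κ) (hP : constantCoeff P = 0) (w₁ w₂ : Fin n → κ)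
    (hw₁ : aeval (fun j : Fin n => (X (some j) : MvPolynomial (Option (Fin n)) κ) + C (w₁ j) * X none) P =
      rename some P + C (eval w₁ P) * (X none) ^ p)
    (hw₂ : aeval (fun j : Fin n => (X (some j) : MvPolynomial (Option (Fin n)) κ) + C (w₂ j) * X none) P =
      rename some P + C (eval w₂ P) * (X none) ^ p) :
    aeval (fun j : Fin n => (X (some j) : MvPolynomial (Option (Fin n)) κ) + C ((w₁ + w₂) j) * X none) P =
      rename some P + C (eval (w₁ + w₂) P) * (X none) ^ p := by
  apply linv_of_const P hP (w₁ + w₂) (eval w₂ P + eval w₁ P)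
  have e1 : (fun j : Fin n => (X (some j) : MvPolynomial (Option (Fin n)) κ) + C ((w₁ + w₂) j) * X none) =
      fun j => ((X (some j) : MvPolynomial (Option (Fin n)) κ) + C (w₂ j) * X none) + C (w₁ j) * X none := by
    funext j
    simp only [Pi.add_apply, C_add]
    ring
  rw [e1, linv_subst P w₁ hw₁ _ (X none), hw₂, map_add]
  ring

/-- The solution set of the invariance identity is closed under scalars (no constant term).
[folklore] -/
theorem linv_smul (P : MvPolynomial (Fin n) κ) (hP : constantCoeff P = 0) (a : κ) (w : Fin n → κ)
    (hw : aeval (fun j : Fin n => (X (some j) : MvPolynomial (Option (Fin n)) κ) + C (w j) * X none) P =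
      rename some P + C (eval w P) * (X none) ^ p) :
    aeval (fun j : Fin n => (X (some j) : MvPolynomial (Option (Fin n)) κ) + C ((a • w) j) * X none) P =
      rename some P + C (eval (a • w) P) * (X none) ^ p := by
  apply linv_of_const P hP (a • w) (eval w P * a ^ p)
  have e1 : (fun j : Fin n => (X (some j) : MvPolynomial (Option (Fin n)) κ) + C ((a • w) j) * X none) =
      fun j => (X (some j) : MvPolynomial (Option (Fin n)) κ) + C (w j) * (C a * X none) := by
    funext j
    simp only [Pi.smul_apply, smul_eq_mul, C_mul]
    ring
  rw [e1, linv_subst P w hw _ (C a * X none), map_mul, C_pow, rename_eq_aeval]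
  simp only [Function.comp_def]
  ring

/-- **The solution set is a subspace**: it coincides with its own `κ`-span (no constant term).
[folklore] -/
theorem span_linv_eq_self (p : ℕ) (P : MvPolynomial (Fin n) κ) (hP : constantCoeff P = 0) :
    (Submodule.span κ {w : Fin n → κ |
        aeval (fun j : Fin n => (X (some j) : MvPolynomial (Option (Fin n)) κ) + C (w j) * X none) P =
          rename some P + C (eval w P) * (X none) ^ p} : Set (Fin n → κ)) =
      {w : Fin n → κ |
        aeval (fun j : Fin n => (X (some j) : MvPolynomial (Option (Fin n)) κ) + C (w j) * X none) P =
          rename some P + C (eval w P) * (X none) ^ p} := by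
  let W : Submodule κ (Fin n → κ) :=
    { carrier := {w : Fin n → κ |
        aeval (fun j : Fin n => (X (some j) : MvPolynomial (Option (Fin n)) κ) + C (w j) * X none) P =
          rename some P + C (eval w P) * (X none) ^ p}
      add_mem' := fun {w₁} {w₂} h₁ h₂ => linv_add P hP w₁ w₂ h₁ h₂
      zero_mem' := linv_zero p P hP
      smul_mem' := fun a w h => linv_smul P hP a w h }
  exact congrArg (fun V : Submodule κ (Fin n → κ) => (V : Set (Fin n → κ))) (Submodule.span_eq W)

/-- **Peeling.** If every `b k` (`k ∈ T`) satisfies the invariance identity, then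
`P(g + Σ_{k∈T} b_k Q_k) = P(g) + Σ_{k∈T} P(b_k) Q_k^p`. [folklore] -/
theorem linv_peel (P : MvPolynomial (Fin n) κ) {ι σ : Type} (b : ι → Fin n → κ)
    (Q : ι → MvPolynomial σ κ) (T : Finset ι)
    (hb : ∀ k ∈ T, aeval (fun j : Fin n => (X (some j) : MvPolynomial (Option (Fin n)) κ) +
        C (b k j) * X none) P = rename some P + C (eval (b k) P) * (X none) ^ p)
    (g : Fin n → MvPolynomial σ κ) :
    aeval (fun j => g j + ∑ k ∈ T, C (b k j) * Q k) P =
      aeval g P + ∑ k ∈ T, C (eval (b k) P) * Q k ^ p := by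
  induction T using Finset.induction_on generalizing g with
  | empty => simp
  | insert k T hk ih =>
    have hbT : ∀ k ∈ T, aeval (fun j : Fin n => (X (some j) : MvPolynomial (Option (Fin n)) κ) +
        C (b k j) * X none) P = rename some P + C (eval (b k) P) * (X none) ^ p :=
      fun k' hk' => hb k' (Finset.mem_insert_of_mem hk')
    have e1 : (fun j => g j + ∑ k ∈ insert k T, C (b k j) * Q k) =
        fun j => (g j + ∑ k ∈ T, C (b k j) * Q k) + C (b k j) * Q k := by
      funext j
      rw [Finset.sum_insert hk]
      ring
    rw [e1, linv_subst P (b k) (hb k (Finset.mem_insert_self k T)) _ (Q k), ih hbT g,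
      Finset.sum_insert hk]
    ring

/-- **Killing a variable.** If `w` satisfies the invariance identity for `P` and `w i = 0`, then `w`
satisfies it for `P|_{X_i = 0}`. [folklore] -/
theorem linv_kill (P : MvPolynomial (Fin n) κ) (i : Fin n) (w : Fin n → κ) (hwi : w i = 0)
    (hw : aeval (fun j : Fin n => (X (some j) : MvPolynomial (Option (Fin n)) κ) + C (w j) * X none) P =
      rename some P + C (eval w P) * (X none) ^ p) :
    aeval (fun j : Fin n => (X (some j) : MvPolynomial (Option (Fin n)) κ) + C (w j) * X none)
        (aeval (fun j : Fin n => if j = i then (0 : MvPolynomial (Fin n) κ) else X j) P) =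
      rename some (aeval (fun j : Fin n => if j = i then (0 : MvPolynomial (Fin n) κ) else X j) P) +
        C (eval w (aeval (fun j : Fin n => if j = i then (0 : MvPolynomial (Fin n) κ) else X j) P)) *
          (X none) ^ p := by
  have h := congrArg (aeval (fun o : Option (Fin n) => Option.elim o (X none : MvPolynomial (Option (Fin n)) κ)
    (fun j => if j = i then 0 else X (some j)))) hw
  rw [comp_aeval_apply, map_add, map_mul, map_pow, aeval_rename, algHom_C, aeval_X,
    algebraMap_eq] at h
  -- the substituted variables
  have e1 : (fun j => aeval (fun o : Option (Fin n) => Option.elim o (X none : MvPolynomial (Option (Fin n)) κ)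
      (fun j => if j = i then 0 else X (some j)))
        ((X (some j) : MvPolynomial (Option (Fin n)) κ) + C (w j) * X none)) =
      fun j => aeval (fun j : Fin n => (X (some j) : MvPolynomial (Option (Fin n)) κ) + C (w j) * X none)
        (if j = i then (0 : MvPolynomial (Fin n) κ) else X j) := by
    funext j
    by_cases hj : j = i
    · subst hj; simp [hwi]
    · simp [hj, algebraMap_eq]
  have e2 : ((fun o : Option (Fin n) => Option.elim o (X none : MvPolynomial (Option (Fin n)) κ)
      (fun j => if j = i then 0 else X (some j))) ∘ some) =
      fun j => aeval (X ∘ some : Fin n → MvPolynomial (Option (Fin n)) κ)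
        (if j = i then (0 : MvPolynomial (Fin n) κ) else X j) := by
    funext j
    by_cases hj : j = i
    · subst hj; simp
    · simp [hj]
  have e3 : eval w (aeval (fun j : Fin n => if j = i then (0 : MvPolynomial (Fin n) κ) else X j) P) = eval w P := by
    rw [← aeval_eq_eval w, comp_aeval_apply]
    have : (fun j => aeval w (if j = i then (0 : MvPolynomial (Fin n) κ) else X j)) = w := by
      funext j
      by_cases hj : j = i
      · subst hj; simp [hwi]
      · simp [hj]
    rw [this]
  rw [comp_aeval_apply, rename_eq_aeval, comp_aeval_apply, e3, ← e1, ← e2, h]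
  simp

/-- A Frobenius form `Σ_l γ_l X_l^p` has only the monomials `X_l^p`. [folklore] -/
theorem coeff_frobeniusForm_eq_zero (p : ℕ) (s : Finset (Fin n)) (γ : Fin n → κ) (m : Fin n →₀ ℕ)
    (hm : ∀ l : Fin n, Finsupp.single l p ≠ m) :
    coeff m (∑ l ∈ s, C (γ l) * (X l : MvPolynomial (Fin n) κ) ^ p) = 0 := by
  rw [coeff_sum]
  refine Finset.sum_eq_zero fun l _ => ?_
  rw [coeff_C_mul, coeff_X_pow, if_neg (hm l), mul_zero]

/-- **Homogeneous substitution along a line.** If every monomial of `P` has degree `p`, then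
`P(v Q) = P(v) Q^p`. [folklore] -/
theorem aeval_smul_line (P : MvPolynomial (Fin n) κ)
    (hP : ∀ m : Fin n →₀ ℕ, coeff m P ≠ 0 → Finsupp.degree m = p)
    (v : Fin n → κ) {σ : Type} (Q : MvPolynomial σ κ) :
    aeval (fun j => C (v j) * Q) P = C (eval v P) * Q ^ p := by
  have key : ∀ d ∈ P.support,
      aeval (fun j => C (v j) * Q) (monomial d (coeff d P)) = C (eval v (monomial d (coeff d P))) * Q ^ p := by
    intro d hd
    have hdeg : ∑ j, d j = p := by
      rw [← Finsupp.degree_eq_sum]; exact hP d (mem_support_iff.mp hd)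
    rw [aeval_monomial, Finsupp.prod_pow, algebraMap_eq, eval_monomial, Finsupp.prod_pow, map_mul,
      map_prod]
    simp only [mul_pow, map_pow]
    rw [Finset.prod_mul_distrib, Finset.prod_pow_eq_pow_sum, hdeg, mul_assoc]
  conv_lhs => rw [as_sum P, map_sum]
  rw [Finset.sum_congr rfl key, ← Finset.sum_mul, ← map_sum, ← map_sum, ← as_sum]

end Summit.ResolutionOfSingularities.ResolutionOfSingularities.Theorems.NoPeriodicIsolatedAtom.RidgeRank

end
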